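import Summits.QuantumFields.YangMills.Theorems.BalabanUVNodesN15KingModelHeatKernelBlockCovPowerLaw
import Summits.QuantumFields.YangMills.Theorems.BalabanUVNodesN15KingModelCombesThomasBlockField
import Summits.QuantumFields.YangMills.Theorems.BalabanUVNodesN15KingModelCombesThomasLocality
import HarnessLib

/-!
# BalabanUVNodes ∕ N15 — THE KING-MODEL RUNG (PART Ϻ-f): THE PRIMAL WOODBURY FORM OF THE FULL BACKGROUND PROPAGATOR AT EVERY UNITARY LINK FIELD AND ITS BLOCKWISE DOMINATION BY KING's SCALAR BOOKS —
# `A₀(U)⁻¹ = M_U⁻¹ − M_U⁻¹Q(U)^*Δ_eff(U)Q(U)M_U⁻¹`; `‖(A₀(U)⁻¹)_{uv} − (M_U⁻¹)_{uv}‖ ≤ L^{−(d+1)}Σ_{b,b′}S_u(b)·‖Δ_eff(U)_{bb′}‖·S^v(b′)` with the SAME scalar block row-sums `S_u`, `S^v` of King's `A = 0` covariance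
# (Kato); the near-zone bound `≤ L^{−(d+1)}(a + 2a²e²∕m²)∕m⁴` at EVERY unitary `U` (mass coercivity), every `L`, every torus, every dimension
# (Track A, DAG node N15 = NE2; FAN-OUT v1.1 §N15 s3 «KING-MODEL RUNG … + what the curved case adds»; count-neutral)

HONEST FRAMING.  Count-neutral (cell `pub-ymgap`, seat `pub-ymgap-dag-n15-e` g56; `--supports stmt-QuantumFields-27247 --as helper` = K3ᴬ, KEY MAP v3).  King's one-level comparison model WITH Bałaban's covariant block
mean along a tree contour system `T` (PART Ϥ: `covQ`, `kingQadjU = L^{d+1}Q(U)ᴴ`, `fullOpU = −cΔ_U + m² + aQ(U)^*Q(U)`, `effLapU = a − a²Q(U)A₀(U)⁻¹Q(U)^*`; the covariant fine covariance `M_U⁻¹ = (covLapF (fine L M) c m² U)⁻¹` of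
PART Ͱ).  Ϻ-a∕Ϻ-d did the flat (`U ≡ 1`, scalar) case; THIS FILE is «what the curved case adds» for the FULL propagator — the same algebra, with every block controlled by King's SCALAR objects:
* §1 ★★ `covLapF_inv_kingQadjU_effLapU` (`M_U⁻¹Q^*Δ_eff(U) = a·A₀(U)⁻¹Q^*`, the covariant twin of King1986 `lapF_inv_transpose_Qmat_mul_effLaplacian`), ★★★ **`fullOpU_inv_eq_woodbury`** (THE PRIMAL WOODBURY FORM AT EVERY
  UNITARY `U`: `A₀(U)⁻¹ = M_U⁻¹ − M_U⁻¹Q(U)^*Δ_eff(U)Q(U)M_U⁻¹`; Ϥ-k proved the dual form `(Δ_eff(U))⁻¹ = a⁻¹ + Q(U)M_U⁻¹Q(U)^*`);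
* §2 ★★ `blk_kingQadjU_mul_mul_covQ_site` (the fine blocks of the middle factor: `(Q^*ΔQ)_{x_j x′_{j′}} = L^{−(d+1)}·U(Γ_{b,x_j})ᴴ·Δ_{bb′}·U(Γ_{b′,x′_{j′}})`), ★★ `norm_blk_kingQadjU_mul_mul_covQ_le`
  (`‖(Q^*ΔQ)_{zz′}‖ ≤ L^{−(d+1)}‖Δ_{β_zβ_{z′}}‖`, unitary transports);
* §3 ★★★ **`norm_blk_fullOpU_inv_sub_le_doubleSum`** (Kato `‖(M_U⁻¹)_{xy}‖ ≤ G(x,y)` (Ͱ-b) on both outer factors + `norm_blk_triple_le` (Ϧ) + regrouping by blocks: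
  `‖(A₀(U)⁻¹)_{uv} − (M_U⁻¹)_{uv}‖ ≤ L^{−(d+1)}Σ_{b,b′}S_u(b)‖Δ_eff(U)_{bb′}‖S^v(b′)` — the flat entry formula of Ϻ-a with `|Δ_eff(b,b′)|` replaced by the operator norm of the covariant block);
* §4 ★★ `norm_blk_effLapU_le_mass` (King's (4.34)(ii) at EVERY unitary `U` with the MASS floor `κ = m²`: `‖Δ_eff(U)_{bb′}‖ ≤ (a + a²(2∕m²)e²)e^{−ctRate(m²,a,d)·d_M(b,b′)}`, PART Ϧ `norm_blk_effLapU_le` ⊕ Ϥ-k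
  `re_quadForm_fullOpU_ge_mass`), ★★★ **`norm_blk_fullOpU_inv_sub_le_near`** (King's scaling `c = L²`: `‖(A₀(U)⁻¹)_{uv} − (M_U⁻¹)_{uv}‖ ≤ L^{−(d+1)}(a + 2a²e²∕m²)∕m⁴` for ALL `u,v`, EVERY unitary `U`, every `L`,
  every torus — the `O(η^{d+1})` near-zone bound of Ϻ-a at curved fields).
HONEST SCOPE: massive (`m² > 0`), `a > 0`, unitary `U`, any `RCLike` fibre, any tree contour system; the decay constants use only the MASS floor (no curvature hypothesis; at small curvature PART Ϧ's classes give
`κ = m² + treeGap` — not restated); NOT Bałaban's multi-level `G_k(U)` ∕ (3.42); NOT a node discharge (N15 of record untouched); nothing continuum ∕ ℝ⁴ ∕ OS ∕ mass gap ∕ Clay.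
PRIOR TREE ART (by name): Ϥ-c∕d∕k (`covQ`, `covQ_apply_site`, `kingQadjU`, `treeHol`, `treeHol_mem_unitaryGroup`, `fullOpU`, `fullOpU_eq_covLapF_add`, `isUnit_fullOpU_massive`, `effLapU`, `re_quadForm_fullOpU_ge_mass`),
Ͱ-a∕b (`covLapF`, `covLapF_mul_inv`, `covLapF_inv_mul`, `l2_opNorm_blk_inv_le`, `lapF_inv_entry_nonneg`, `l2_opNorm_of_mem_unitaryGroup_le`), Ϧ (`norm_blk_effLapU_le`, `ctRate`, `ctRate_pos`, `norm_blk_triple_le`,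
`blk_sub'`), Ϻ-a (`blockSum_lapF_inv_nonneg`∕`_col_nonneg`, `sum_blockSum_lapF_inv_row`∕`_col`, `abs_doubleSum_le_of_abs_le`), King1986.Torus (`lapF`, `blockSum`, `blockEquiv`, `site`, `blockOf`, `exists_eq_site`, `tdistT_nonneg`),
`LatticeDiamagneticInequality.blk`.  Dedup (rg at filing): basename 0 files; needles `fullOpU_inv_eq_woodbury|covLapF_inv_kingQadjU_effLapU|blk_kingQadjU_mul_mul_covQ|norm_blk_fullOpU_inv_sub_le_doubleSum|norm_blk_effLapU_le_mass|norm_blk_fullOpU_inv_sub_le_near`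
0 tree files.  presearch: n/a (finite-dimensional matrix algebra on in-tree objects).  Locators: [King1986] (2.13)–(2.14) p.653, (4.34) p.674, (4.44)–(4.45) p.675; [Balaban1985BackgroundPropagators] (3.19) p.393,
(3.24)–(3.25) p.394; [Balaban1984PropagatorsI] (1.29) p.23; [Dimock2013] App. D Lemma 30; [DodziukMathai2006] Thm 1.5 §1.  0 `sorry`, 0 `def`.
-/

noncomputable section

open scoped BigOperators ComplexConjugate ComplexOrder Matrix.Norms.L2Operator
open Finset Matrix

namespace Summit.QuantumFields.YangMills.BalabanUVNodes.N15KingModelRung.HeatKernel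

open Literature.MathematicalPhysics.QuantumFieldTheory.LatticeDiamagneticInequality (blk)
open Literature.MathematicalPhysics.QuantumFieldTheory.Balaban1983to89.B5Prop11Plancherel (Tor fine)
open Literature.MathematicalPhysics.QuantumFieldTheory.King1986.Torus (lapF blockSum blockEquiv blockEquiv_apply site site_injective blockOf blockOf_site exists_eq_site tdistT tdistT_nonneg)
open Summit.QuantumFields.YangMills.BalabanUVNodes.N15KingModelRung.Covariant (covLapF covLapF_mul_inv covLapF_inv_mul l2_opNorm_blk_inv_le lapF_inv_entry_nonneg l2_opNorm_of_mem_unitaryGroup_le fib)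
open Summit.QuantumFields.YangMills.BalabanUVNodes.N15KingModelRung.CovariantBlock
  (BlockTree treeHol treeHol_mem_unitaryGroup covQ covQ_apply_site kingQadjU fullOpU fullOpU_eq_covLapF_add isUnit_fullOpU_massive effLapU re_quadForm_fullOpU_ge_mass)
open Summit.QuantumFields.YangMills.BalabanUVNodes.N15KingModelRung.CombesThomas (norm_blk_effLapU_le ctRate ctRate_pos norm_blk_triple_le)

variable {d : ℕ} {L : ℕ} [NeZero L] (T : BlockTree d L) (M : Fin (d + 1) → ℕ) [hM : ∀ μ, NeZero (M μ)]
variable {𝕜 : Type*} [RCLike 𝕜] {n : Type*} [Fintype n] [DecidableEq n]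

/-! ## §1 The primal Woodbury form at every unitary `U` -/

/-- ★★ `M_U⁻¹·Q(U)^*·Δ_eff(U) = a·A₀(U)⁻¹·Q(U)^*` at every unitary `U` (`a > 0`, `c ≥ 0`, `m² > 0`): the covariant twin of King1986 `lapF_inv_transpose_Qmat_mul_effLaplacian`.
[cite: King1986, (2.14) p.653, (4.44)–(4.45) p.675; Balaban1985BackgroundPropagators, (3.25) p.394] -/
theorem covLapF_inv_kingQadjU_effLapU {a c m2 : ℝ} (ha : 0 < a) (hc : 0 ≤ c) (hm : 0 < m2) {U : Tor (fine L M) × Fin (d + 1) → Matrix n n 𝕜} (hU : ∀ bd, U bd ∈ Matrix.unitaryGroup n 𝕜) :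
    (covLapF (fine L M) c m2 U)⁻¹ * kingQadjU T M U * effLapU T M a c m2 U = (a : 𝕜) • ((fullOpU T M a c m2 U)⁻¹ * kingQadjU T M U) := by
  set Q := covQ T M U with hQ
  set Qs := kingQadjU T M U with hQs
  set Mm := covLapF (fine L M) c m2 U with hMm
  set A := fullOpU T M a c m2 U with hA
  have hAunit := (Matrix.isUnit_iff_isUnit_det _).mp (isUnit_fullOpU_massive T M ha.le hc hm hU)
  have hAG : A * A⁻¹ = 1 := Matrix.mul_nonsing_inv _ hAunit
  have hGM : Mm⁻¹ * Mm = 1 := covLapF_inv_mul (fine L M) hc hm hU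
  have hpen : (a : 𝕜) • (Qs * Q) = A - Mm := by rw [hA, fullOpU_eq_covLapF_add]; abel
  have h2c : ((a ^ 2 : ℝ) : 𝕜) = (a : 𝕜) * (a : 𝕜) := by push_cast; ring
  have hΔ : effLapU T M a c m2 U = (a : 𝕜) • 1 - ((a ^ 2 : ℝ) : 𝕜) • (Q * A⁻¹ * Qs) := rfl
  calc Mm⁻¹ * Qs * effLapU T M a c m2 U
      = (a : 𝕜) • (Mm⁻¹ * Qs) - ((a : 𝕜) * (a : 𝕜)) • (Mm⁻¹ * (Qs * Q) * A⁻¹ * Qs) := by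
        rw [hΔ, Matrix.mul_sub, Matrix.mul_smul, Matrix.mul_one, Matrix.mul_smul, h2c]
        simp only [Matrix.mul_assoc]
    _ = (a : 𝕜) • (Mm⁻¹ * Qs) - (a : 𝕜) • (Mm⁻¹ * (A - Mm) * A⁻¹ * Qs) := by
        rw [← hpen, Matrix.mul_smul, Matrix.smul_mul, Matrix.smul_mul, smul_smul]
    _ = (a : 𝕜) • (Mm⁻¹ * Qs) - (a : 𝕜) • ((Mm⁻¹ - A⁻¹) * Qs) := by
        rw [Matrix.mul_sub, Matrix.sub_mul, hGM, Matrix.one_mul, Matrix.mul_assoc Mm⁻¹ A A⁻¹, hAG, Matrix.mul_one]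
    _ = (a : 𝕜) • (A⁻¹ * Qs) := by rw [Matrix.sub_mul, smul_sub]; abel

/-- ★★★ **THE PRIMAL WOODBURY FORM OF THE FULL BACKGROUND PROPAGATOR AT EVERY UNITARY LINK FIELD**: `A₀(U)⁻¹ = M_U⁻¹ − M_U⁻¹·Q(U)^*·Δ_eff(U)·Q(U)·M_U⁻¹` (`a > 0`, `c ≥ 0`, `m² > 0`, every tree contour system).
[cite: King1986, (2.13)–(2.14) p.653, (4.44)–(4.45) p.675; Balaban1984PropagatorsI, (1.29) p.23; Balaban1985BackgroundPropagators, (3.24)–(3.25) p.394] -/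
theorem fullOpU_inv_eq_woodbury {a c m2 : ℝ} (ha : 0 < a) (hc : 0 ≤ c) (hm : 0 < m2) {U : Tor (fine L M) × Fin (d + 1) → Matrix n n 𝕜} (hU : ∀ bd, U bd ∈ Matrix.unitaryGroup n 𝕜) :
    (fullOpU T M a c m2 U)⁻¹ = (covLapF (fine L M) c m2 U)⁻¹
      - (covLapF (fine L M) c m2 U)⁻¹ * kingQadjU T M U * effLapU T M a c m2 U * covQ T M U * (covLapF (fine L M) c m2 U)⁻¹ := by
  set Q := covQ T M U with hQ
  set Qs := kingQadjU T M U with hQs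
  set Mm := covLapF (fine L M) c m2 U with hMm
  set A := fullOpU T M a c m2 U with hA
  have hAunit := (Matrix.isUnit_iff_isUnit_det _).mp (isUnit_fullOpU_massive T M ha.le hc hm hU)
  have hGA : A⁻¹ * A = 1 := Matrix.nonsing_inv_mul _ hAunit
  have hMG : Mm * Mm⁻¹ = 1 := covLapF_mul_inv (fine L M) hc hm hU
  have hpen : (a : 𝕜) • (Qs * Q) = A - Mm := by rw [hA, fullOpU_eq_covLapF_add]; abel
  have h1 := covLapF_inv_kingQadjU_effLapU T M ha hc hm hU
  have h2 : Mm⁻¹ * Qs * effLapU T M a c m2 U * Q * Mm⁻¹ = Mm⁻¹ - A⁻¹ := by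
    rw [h1, Matrix.smul_mul, Matrix.smul_mul, Matrix.mul_assoc A⁻¹ Qs Q, ← Matrix.smul_mul, ← Matrix.mul_smul, hpen, Matrix.mul_sub, Matrix.sub_mul, hGA, Matrix.one_mul,
      Matrix.mul_assoc A⁻¹ Mm Mm⁻¹, hMG, Matrix.mul_one]
  rw [h2, sub_sub_cancel]

/-! ## §2 The fine blocks of the middle factor `Q(U)^*·Δ·Q(U)` -/

/-- The entries of King's adjoint at a block point: `Q(U)^*((site b′ j, k),(b,i)) = [b = b′]·conj(U(Γ_{b,site b j})_{ik})`. [cite: Balaban1985BackgroundPropagators, (3.19) p.393; King1986, (2.11) p.653] -/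
theorem kingQadjU_apply_site (U : Tor (fine L M) × Fin (d + 1) → Matrix n n 𝕜) (b b' : Tor M) (i k : n) (j : Fin (d + 1) → Fin L) :
    kingQadjU T M U (site L M b' j, k) (b, i) = if b = b' then star (treeHol M T U b j i k) else 0 := by
  have hL : ((L : 𝕜) ^ (d + 1)) ≠ 0 := pow_ne_zero _ (by exact_mod_cast NeZero.ne L)
  simp only [kingQadjU, Matrix.smul_apply, Matrix.conjTranspose_apply, covQ_apply_site, smul_eq_mul]
  by_cases h : b = b'
  · rw [if_pos h, if_pos h, star_mul', RCLike.star_def, map_inv₀, map_pow, map_natCast, ← mul_assoc, mul_inv_cancel₀ hL, one_mul]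
  · rw [if_neg h, if_neg h, star_zero, mul_zero]

/-- ★★ **THE FINE BLOCKS OF `Q(U)^*ΔQ(U)`**: `(Q^*ΔQ)_{x_j, x′_{j′}} = L^{−(d+1)}·U(Γ_{b,x_j})ᴴ·Δ_{bb′}·U(Γ_{b′,x′_{j′}})` (`x_j = site b j`, `x′_{j′} = site b′ j′`).
[cite: Balaban1985BackgroundPropagators, (3.19) p.393; King1986, (2.13)–(2.14) p.653] -/
theorem blk_kingQadjU_mul_mul_covQ_site (Δ : Matrix (Tor M × n) (Tor M × n) 𝕜) (U : Tor (fine L M) × Fin (d + 1) → Matrix n n 𝕜) (b b' : Tor M) (j j' : Fin (d + 1) → Fin L) :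
    blk (kingQadjU T M U * Δ * covQ T M U) (site L M b j) (site L M b' j')
      = ((L : 𝕜) ^ (d + 1))⁻¹ • ((treeHol M T U b j)ᴴ * blk Δ b b' * treeHol M T U b' j') := by
  ext i k
  rw [Matrix.smul_apply, smul_eq_mul]
  simp only [blk, Matrix.of_apply]
  rw [Matrix.mul_apply, Fintype.sum_prod_type, Finset.sum_eq_single b']
  · -- the outer sum sits on block `b′`
    have hinner : ∀ k' : n, (kingQadjU T M U * Δ) (site L M b j, i) (b', k') = ∑ i', star (treeHol M T U b j i' i) * Δ (b, i') (b', k') := by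
      intro k'
      rw [Matrix.mul_apply, Fintype.sum_prod_type, Finset.sum_eq_single b]
      · exact Finset.sum_congr rfl fun i' _ => by rw [kingQadjU_apply_site, if_pos rfl]
      · intro b'' _ hb''
        exact Finset.sum_eq_zero fun i' _ => by rw [kingQadjU_apply_site, if_neg hb'', zero_mul]
      · intro h; exact absurd (Finset.mem_univ b) h
    simp only [hinner, covQ_apply_site, if_true]
    rw [Matrix.mul_apply, Finset.mul_sum]
    refine Finset.sum_congr rfl fun k' _ => ?_
    rw [Matrix.mul_apply]
    simp only [Matrix.conjTranspose_apply, Matrix.of_apply]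
    rw [Finset.sum_mul, Finset.sum_mul, Finset.mul_sum]
    exact Finset.sum_congr rfl fun i' _ => by ring
  · intro b'' _ hb''
    refine Finset.sum_eq_zero fun k' _ => ?_
    rw [covQ_apply_site, if_neg hb'', mul_zero]
  · intro h; exact absurd (Finset.mem_univ b') h

/-- ★★ **THE MIDDLE BLOCKS ARE DOMINATED BY THE BLOCK-LATTICE BLOCKS**: for unitary `U`, `‖(Q(U)^*ΔQ(U))_{zz′}‖ ≤ L^{−(d+1)}·‖Δ_{β_z β_{z′}}‖` (`β_z = blockOf z`). [cite: Balaban1985BackgroundPropagators, (3.19) p.393] -/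
theorem norm_blk_kingQadjU_mul_mul_covQ_le (Δ : Matrix (Tor M × n) (Tor M × n) 𝕜) {U : Tor (fine L M) × Fin (d + 1) → Matrix n n 𝕜} (hU : ∀ bd, U bd ∈ Matrix.unitaryGroup n 𝕜)
    (z z' : Tor (fine L M)) :
    ‖blk (kingQadjU T M U * Δ * covQ T M U) z z'‖ ≤ ((L : ℝ) ^ (d + 1))⁻¹ * ‖blk Δ (blockOf L M z) (blockOf L M z')‖ := by
  obtain ⟨j, hj⟩ := exists_eq_site L M z
  obtain ⟨j', hj'⟩ := exists_eq_site L M z'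
  rw [hj, hj', blockOf_site, blockOf_site, blk_kingQadjU_mul_mul_covQ_site, norm_smul, norm_inv, norm_pow, RCLike.norm_natCast]
  refine mul_le_mul_of_nonneg_left ?_ (by positivity)
  have h1 : ‖(treeHol M T U (blockOf L M z) j)ᴴ‖ ≤ 1 := by
    have : (treeHol M T U (blockOf L M z) j)ᴴ ∈ Matrix.unitaryGroup n 𝕜 := by
      simpa only [star_eq_conjTranspose] using Unitary.star_mem (treeHol_mem_unitaryGroup T M hU (blockOf L M z) j)
    exact l2_opNorm_of_mem_unitaryGroup_le this
  have h2 := l2_opNorm_of_mem_unitaryGroup_le (treeHol_mem_unitaryGroup T M hU (blockOf L M z') j')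
  calc ‖(treeHol M T U (blockOf L M z) j)ᴴ * blk Δ (blockOf L M z) (blockOf L M z') * treeHol M T U (blockOf L M z') j'‖
      ≤ ‖(treeHol M T U (blockOf L M z) j)ᴴ‖ * ‖blk Δ (blockOf L M z) (blockOf L M z')‖ * ‖treeHol M T U (blockOf L M z') j'‖ :=
        (norm_mul_le _ _).trans (mul_le_mul_of_nonneg_right (norm_mul_le _ _) (norm_nonneg _))
    _ ≤ 1 * ‖blk Δ (blockOf L M z) (blockOf L M z')‖ * 1 := by gcongr
    _ = ‖blk Δ (blockOf L M z) (blockOf L M z')‖ := by ring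

/-! ## §3 The blockwise domination of `A₀(U)⁻¹ − M_U⁻¹` by King's scalar double sum -/

/-- A sum over the fine torus is a sum over blocks and offsets (`blockEquiv`). [folklore] -/
theorem sum_fine_eq_sum_blocks (f : Tor (fine L M) → ℝ) : ∑ z, f z = ∑ b : Tor M, ∑ j : Fin (d + 1) → Fin L, f (site L M b j) := by
  rw [← (blockEquiv L M).sum_comp, Fintype.sum_prod_type]
  simp only [blockEquiv_apply]

/-- ★★★ **THE CURVED BLOCK CORRECTION IS DOMINATED BY KING's SCALAR BOOKS**: for every unitary `U` (`a > 0`, `c ≥ 0`, `m² > 0`) and all fine points `u, v`,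
`‖(A₀(U)⁻¹)_{uv} − (M_U⁻¹)_{uv}‖ ≤ L^{−(d+1)}·Σ_{b,b′}S_u(b)·‖Δ_eff(U)_{bb′}‖·S^v(b′)` with the SCALAR block row∕column sums `S_u(b) = Σ_{x∈B(b)}G(u,x)`, `S^v(b′) = Σ_{x∈B(b′)}G(x,v)` of King's `A = 0` covariance
`G = (c(−Δ)+m²)⁻¹` (Kato domination of the two outer factors). [cite: King1986, (4.44)–(4.45) p.675; Balaban1985BackgroundPropagators, (3.23) p.394, (3.25) p.394; DodziukMathai2006, Thm 1.5 §1] -/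
theorem norm_blk_fullOpU_inv_sub_le_doubleSum {a c m2 : ℝ} (ha : 0 < a) (hc : 0 ≤ c) (hm : 0 < m2) {U : Tor (fine L M) × Fin (d + 1) → Matrix n n 𝕜} (hU : ∀ bd, U bd ∈ Matrix.unitaryGroup n 𝕜)
    (u v : Tor (fine L M)) :
    ‖blk ((fullOpU T M a c m2 U)⁻¹) u v - blk ((covLapF (fine L M) c m2 U)⁻¹) u v‖
      ≤ ((L : ℝ) ^ (d + 1))⁻¹ * ∑ b, ∑ b', blockSum L M (fun x => (lapF (fine L M) c m2)⁻¹ u x) b * ‖blk (effLapU T M a c m2 U) b b'‖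
          * blockSum L M (fun x => (lapF (fine L M) c m2)⁻¹ x v) b' := by
  set G := (lapF (fine L M) c m2)⁻¹ with hG
  set X := kingQadjU T M U * effLapU T M a c m2 U * covQ T M U with hX
  have hLd : 0 < ((L : ℝ) ^ (d + 1)) := pow_pos (by exact_mod_cast Nat.pos_of_ne_zero (NeZero.ne L)) _
  -- the Woodbury difference as a triple product
  have hdiff : blk ((fullOpU T M a c m2 U)⁻¹) u v - blk ((covLapF (fine L M) c m2 U)⁻¹) u v
      = -blk ((covLapF (fine L M) c m2 U)⁻¹ * X * (covLapF (fine L M) c m2 U)⁻¹) u v := by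
    rw [fullOpU_inv_eq_woodbury T M ha hc hm hU]
    have e : (covLapF (fine L M) c m2 U)⁻¹ * kingQadjU T M U * effLapU T M a c m2 U * covQ T M U * (covLapF (fine L M) c m2 U)⁻¹
        = (covLapF (fine L M) c m2 U)⁻¹ * X * (covLapF (fine L M) c m2 U)⁻¹ := by simp only [hX, Matrix.mul_assoc]
    rw [e]
    ext i k
    simp only [blk, Matrix.of_apply, Matrix.sub_apply, Matrix.neg_apply]
    ring
  rw [hdiff, norm_neg]
  -- triple domination
  refine (norm_blk_triple_le (fine L M) _ _ _ u v).trans ?_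
  have hpt : ∀ z z', ‖blk ((covLapF (fine L M) c m2 U)⁻¹) u z‖ * ‖blk X z z'‖ * ‖blk ((covLapF (fine L M) c m2 U)⁻¹) z' v‖
      ≤ G u z * (((L : ℝ) ^ (d + 1))⁻¹ * ‖blk (effLapU T M a c m2 U) (blockOf L M z) (blockOf L M z')‖) * G z' v := by
    intro z z'
    have h1 := l2_opNorm_blk_inv_le (fine L M) hc hm hU u z
    have h2 := norm_blk_kingQadjU_mul_mul_covQ_le T M (effLapU T M a c m2 U) hU z z'
    have h3 := l2_opNorm_blk_inv_le (fine L M) hc hm hU z' v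
    have hG1 : 0 ≤ G u z := lapF_inv_entry_nonneg (fine L M) hc hm u z
    gcongr
  refine (Finset.sum_le_sum fun z _ => Finset.sum_le_sum fun z' _ => hpt z z').trans (le_of_eq ?_)
  -- regroup the fine sums by blocks
  simp only [sum_fine_eq_sum_blocks M, blockOf_site]
  rw [Finset.mul_sum]
  refine Finset.sum_congr rfl fun b _ => ?_
  rw [Finset.sum_comm, Finset.mul_sum]
  refine Finset.sum_congr rfl fun b' _ => ?_
  simp only [blockSum, Finset.sum_mul, Finset.mul_sum]
  rw [Finset.sum_comm]
  refine Finset.sum_congr rfl fun j _ => Finset.sum_congr rfl fun j' _ => ?_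
  ring

/-! ## §4 The near zone at every unitary `U` (mass coercivity) -/

/-- ★★ **KING's (4.34)(ii) AT EVERY UNITARY LINK FIELD FROM THE MASS FLOOR ALONE** (King's scaling `c = L²`, `a ≥ 0`, `m² > 0`, `L ≥ 1`): `‖Δ_eff(U)_{bb′}‖ ≤ (a + a²(2∕m²)e²)·e^{−ctRate(m²,a,d)·d_M(b,b′)}`
(PART Ϧ `norm_blk_effLapU_le` with `κ = m²` from Ϥ-k `re_quadForm_fullOpU_ge_mass` — no curvature hypothesis). [cite: King1986, (4.34) p.674; Dimock2013, App. D Lemma 30; Balaban1985BackgroundPropagators, (3.24) p.394] -/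
theorem norm_blk_effLapU_le_mass {a m2 : ℝ} (ha : 0 ≤ a) (hm : 0 < m2) {U : Tor (fine L M) × Fin (d + 1) → Matrix n n 𝕜} (hU : ∀ bd, U bd ∈ Matrix.unitaryGroup n 𝕜) (b b' : Tor M) :
    ‖blk (effLapU T M a ((L : ℝ) ^ 2) m2 U) b b'‖ ≤ (a + a ^ 2 * (2 / m2) * Real.exp 2) * Real.exp (-(ctRate m2 a d * tdistT M b b')) :=
  norm_blk_effLapU_le T M ha m2 hU hm (fun v => re_quadForm_fullOpU_ge_mass T M ha (by positivity) m2 hU v) (Nat.one_le_iff_ne_zero.mpr (NeZero.ne L)) b b'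

/-- ★★★ **THE NEAR-ZONE BOUND AT EVERY UNITARY LINK FIELD** (King's scaling `c = L²`, `a, m² > 0`, every `L ≥ 1`, every torus, ALL `u, v`):
`‖(A₀(U)⁻¹)_{uv} − (M_U⁻¹)_{uv}‖ ≤ L^{−(d+1)}·(a + 2a²e²∕m²)∕m⁴` — Ϻ-a's `O(η^{d+1})` block correction at curved fields, with the mass floor in place of `γ_A`.
[cite: King1986, (2.13)–(2.14) p.653, (4.34) p.674, (4.44)–(4.45) p.675; Dimock2013, App. D Lemma 30] -/
theorem norm_blk_fullOpU_inv_sub_le_near {a m2 : ℝ} (ha : 0 < a) (hm : 0 < m2) {U : Tor (fine L M) × Fin (d + 1) → Matrix n n 𝕜} (hU : ∀ bd, U bd ∈ Matrix.unitaryGroup n 𝕜) (u v : Tor (fine L M)) :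
    ‖blk ((fullOpU T M a ((L : ℝ) ^ 2) m2 U)⁻¹) u v - blk ((covLapF (fine L M) ((L : ℝ) ^ 2) m2 U)⁻¹) u v‖
      ≤ ((L : ℝ) ^ (d + 1))⁻¹ * ((a + a ^ 2 * (2 / m2) * Real.exp 2) / m2 ^ 2) := by
  have hc : (0 : ℝ) ≤ (L : ℝ) ^ 2 := by positivity
  have hLd : 0 < ((L : ℝ) ^ (d + 1)) := pow_pos (by exact_mod_cast Nat.pos_of_ne_zero (NeZero.ne L)) _
  have hK : ∀ b b', |‖blk (effLapU T M a ((L : ℝ) ^ 2) m2 U) b b'‖| ≤ a + a ^ 2 * (2 / m2) * Real.exp 2 := by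
    intro b b'
    rw [abs_of_nonneg (norm_nonneg _)]
    refine (norm_blk_effLapU_le_mass T M ha.le hm hU b b').trans ?_
    have h1 : Real.exp (-(ctRate m2 a d * tdistT M b b')) ≤ 1 := by
      rw [Real.exp_le_one_iff, neg_nonpos]; exact mul_nonneg (ctRate_pos hm ha.le d).le (tdistT_nonneg M b b')
    have h0 : 0 ≤ a + a ^ 2 * (2 / m2) * Real.exp 2 := by positivity
    calc (a + a ^ 2 * (2 / m2) * Real.exp 2) * Real.exp (-(ctRate m2 a d * tdistT M b b')) ≤ (a + a ^ 2 * (2 / m2) * Real.exp 2) * 1 := mul_le_mul_of_nonneg_left h1 h0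
      _ = _ := mul_one _
  refine (norm_blk_fullOpU_inv_sub_le_doubleSum T M ha hc hm hU u v).trans (mul_le_mul_of_nonneg_left ?_ (inv_pos.mpr hLd).le)
  have h := abs_doubleSum_le_of_abs_le M (blockSum_lapF_inv_nonneg L M hc hm u) (blockSum_lapF_inv_col_nonneg L M hc hm v) hK
  rw [sum_blockSum_lapF_inv_row L M hc hm u, sum_blockSum_lapF_inv_col L M hc hm v] at h
  refine (le_abs_self _).trans (h.trans (le_of_eq ?_))
  field_simp

end Summit.QuantumFields.YangMills.BalabanUVNodes.N15KingModelRung.HeatKernel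

end
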